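import Summits.CriticalPhenomena.PercolationContinuityZ3.Theorems.PercNearOneGluingNoHeavyLowerTailCubicFourPointL1ThmCertMeasure
import Summits.CriticalPhenomena.PercolationContinuityZ3.Theorems.PercNearOneGluingNoHeavyLowerTailCubicFourPointL1Relabel
import HarnessLib

/-!
# **(L1) for every edge system** — `CubicFourPointL1.L1Conj V` holds for every vertex type: all finite random edge sets `D`,
# forced sets `K`, weights `p ∈ [0,1]`, labels `a b c y` (coincidences allowed): `0 ≤ l1W D p K a b c y`, i.e. `E1 + E2 ≥ β·P(b ≁ c)`

Prover prim-l12-p2 (`--supports stmt-CriticalPhenomena-4575`).  No definitions, no sorries, no named facts, standard axioms (the ancestry is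
prim-cert-2's KERNEL replay `L1ThmCert.polarisedRowL1` of prim-l12-p6's theorem-rows certificate of (L1) — no `native_decide`).
This closes the seat's conjecture `CubicFourPointL1.L1Conj` (`…CubicFourPointL1Step`, the target of the deletion–contraction line) in its own
vocabulary and full generality: `PolarisedRowL1` (all coordinates random, no forced edges, `V : Type`) is moved to arbitrary `(D, K, p)` by
prim-bnk-1's `massesW_eq_univ` (forced edges = weight-one coordinates, absent edges = weight zero) and to an arbitrary vertex type (any universe)
by the injective-relabelling transport `l1W_image` onto `Fin |T|`, `T` = the finite set of endpoints and labels.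
* `l1W_nonneg_of_fintype` (finite `V : Type`), `l1W_nonneg_of_finset`, **`l1W_nonneg`**, **`l1Conj_holds : L1Conj V`**.
Consequently the hypothesis `L1StepHyp` of `l1W_nonneg_of_stepHyp` is no longer needed, and every move/closure theorem of the line
(`…L1Cells/CutFace/Moves/EdgeMoves/PendantB/ForestPrep`) is superseded as far as (L1) itself is concerned.  (A second, independent derivation —
prim-facecert's 261-row certificate replayed by the generic checker `FourPointCert` of `…L1CertKernel/Semantics/Patterns/Glue/Rows`, identity
decided computationally in `…L1Cert` — gives the same cell-level statement `FourPointCert.L1hom (cellLaw …) ≥ 0`.) [this work]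
-/

noncomputable section

namespace Summit.CriticalPhenomena.PercolationContinuityZ3.Theorems

namespace CubicFourPointL1

open Finset Literature.Probability.LatticeModels

/-- **(L1) for every edge system on a finite vertex type** (`V : Type`): all `D, K, p ∈ [0,1], a, b, c, y`. [this work] -/
theorem l1W_nonneg_of_fintype {V : Type} [Fintype V] [DecidableEq V] (D K : Finset (Sym2 V)) (p : Sym2 V → ℝ)
    (hp0 : ∀ e, 0 ≤ p e) (hp1 : ∀ e, p e ≤ 1) (a b c y : V) : 0 ≤ l1W D p K a b c y := by
  let w' : Sym2 V → unitInterval := fun e =>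
    ⟨if e ∈ K then (1 : ℝ) else if e ∈ D then p e else 0, by
      by_cases hK : e ∈ K
      · simp only [hK, if_true]; exact ⟨zero_le_one, le_rfl⟩
      · by_cases hD : e ∈ D
        · simp only [hK, hD, if_false, if_true]; exact ⟨hp0 e, hp1 e⟩
        · simp only [hK, hD, if_false]; exact ⟨le_rfl, zero_le_one⟩⟩
  have hw : (fun e => (w' e : ℝ)) = fun e => if e ∈ K then (1 : ℝ) else if e ∈ D then p e else 0 := rfl
  unfold l1W
  rw [massesW_eq_univ D K p a b c y, ← hw]
  exact TerminalEdgeStep.l1W_univ_nonneg_of_polarisedRowL1 L1ThmCert.polarisedRowL1 w' a b c y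

/-- **(L1) for every edge system whose edges and labels lie in a finite vertex set** (arbitrary vertex type and universe). [this work] -/
theorem l1W_nonneg_of_finset {V : Type*} [DecidableEq V] (T : Finset V) (D K : Finset (Sym2 V)) (p : Sym2 V → ℝ)
    (hp0 : ∀ e, 0 ≤ p e) (hp1 : ∀ e, p e ≤ 1) (hD : ∀ e ∈ D, ∀ v ∈ e, v ∈ T) (hK : ∀ e ∈ K, ∀ v ∈ e, v ∈ T)
    (a b c y : V) (ha : a ∈ T) (hb : b ∈ T) (hc : c ∈ T) (hy : y ∈ T) : 0 ≤ l1W D p K a b c y := by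
  let g : Fin T.card → V := fun i => ((T.equivFin.symm i : T) : V)
  have hg : Function.Injective g := fun i j h => T.equivFin.symm.injective (Subtype.ext h)
  have hrange : ∀ v ∈ T, v ∈ Set.range g := fun v hv =>
    ⟨T.equivFin ⟨v, hv⟩, by simp only [g, Equiv.symm_apply_apply]⟩
  obtain ⟨D₀, hD₀⟩ := exists_preimage_edges (φ := g) D fun e he v hv => hrange v (hD e he v hv)
  obtain ⟨K₀, hK₀⟩ := exists_preimage_edges (φ := g) K fun e he v hv => hrange v (hK e he v hv)
  obtain ⟨a₀, ha₀⟩ := hrange a ha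
  obtain ⟨b₀, hb₀⟩ := hrange b hb
  obtain ⟨c₀, hc₀⟩ := hrange c hc
  obtain ⟨y₀, hy₀⟩ := hrange y hy
  rw [← hD₀, ← hK₀, ← ha₀, ← hb₀, ← hc₀, ← hy₀, l1W_image hg]
  exact l1W_nonneg_of_fintype D₀ K₀ (p ∘ Sym2.map g) (fun e => hp0 _) (fun e => hp1 _) a₀ b₀ c₀ y₀

/-- **(L1) for EVERY edge system**: `0 ≤ l1W D p K a b c y` for all finite `D, K`, weights `p ∈ [0,1]` and labels `a, b, c, y` on any
vertex type, i.e. `E3(D_bc,D_ac,G_ab) + E3(D_bc,G_ac,D_ab) ≥ β·P(b ≁ c)` with forced edges and coincident labels allowed. [this work] -/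
theorem l1W_nonneg {V : Type*} [DecidableEq V] (D K : Finset (Sym2 V)) (p : Sym2 V → ℝ) (hp0 : ∀ e, 0 ≤ p e) (hp1 : ∀ e, p e ≤ 1)
    (a b c y : V) : 0 ≤ l1W D p K a b c y := by
  let verts : Sym2 V → Finset V := fun e => {e.out.1, e.out.2}
  have hverts : ∀ (e : Sym2 V), ∀ v ∈ e, v ∈ verts e := by
    intro e v hv
    have he : s(e.out.1, e.out.2) = e := e.out_eq
    rw [← he, Sym2.mem_iff] at hv
    rcases hv with rfl | rfl
    · exact Finset.mem_insert_self _ _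
    · exact Finset.mem_insert_of_mem (Finset.mem_singleton_self _)
  let T : Finset V := (D ∪ K).biUnion verts ∪ {a, b, c, y}
  have hDK : ∀ e ∈ D ∪ K, ∀ v ∈ e, v ∈ T := fun e he v hv =>
    Finset.mem_union_left _ (Finset.mem_biUnion.2 ⟨e, he, hverts e v hv⟩)
  have hl : ∀ v ∈ ({a, b, c, y} : Finset V), v ∈ T := fun v hv => Finset.mem_union_right _ hv
  exact l1W_nonneg_of_finset T D K p hp0 hp1 (fun e he => hDK e (Finset.mem_union_left _ he))
    (fun e he => hDK e (Finset.mem_union_right _ he)) a b c y (hl a (by simp)) (hl b (by simp)) (hl c (by simp)) (hl y (by simp))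

/-- **`L1Conj` holds on every vertex type**: the polarised E3GRP form (L1) for every finite weighted graph, every forced set, all labels.
[this work] -/
theorem l1Conj_holds (V : Type*) [DecidableEq V] : L1Conj V :=
  fun D K p hp0 hp1 a b c y => l1W_nonneg D K p hp0 hp1 a b c y

end CubicFourPointL1

end Summit.CriticalPhenomena.PercolationContinuityZ3.Theorems
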